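import Literature.AlgebraicGeometry.Pohlmann1968.HodgeClassesProductSpanCMProductsSharp
import Literature.AlgebraicGeometry.Pohlmann1968.HodgeClassesProductSpanCMProductsSlots
import Literature.AlgebraicGeometry.Milne1999.WeilClassStabilizer
import Literature.NumberTheory.ComplexMultiplication.CMTypeRankTwoBlocksNatWeights
import HarnessLib

/-!
# Moonen–Zarhin's criterion (3.1) is an EQUIVALENCE for CM abelian varieties: `Hg(X × Y) = Hg(X) × Hg(Y)` iff the
# Hodge classes of ALL products of copies `X^k × Y^l` are spanned by exterior products of Hodge classes of the factors

Family `hodge`, layer `Literature/AlgebraicGeometry/Pohlmann1968`; cell `pub-hodgecm2` (COR-CM), count-neutral own-lane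
sequel of `Pohlmann1968/HodgeClassesProductSpanCMProductsSlots` (rank additivity ⟹ product span for all products of
copies) and `…CMProductsSharp` (product span for `(⨁ A, ⨁ A')` ⟺ every glued-balanced `0/1`-weight splits).  HONEST
FRAMING: unconditional structure theorem on Hodge classes of CM abelian varieties; not a step of the summit chain.

THE THEOREM (`typeRank_sum_add_one_eq_iff_forall_hodgeClassesProductSpan_slots`).  `X = ⨁_{i<n} A_i`, `Y = ⨁_{j<m} A'_j`
products of realisations of CM types `Φ_i` of CM fields `K_i`, `Φ'_j` of `K'_j`; `Σ`, `Σ'` the family types.  Then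
`rank(Σ ⊔ Σ') + 1 = cmFamilyRank Φ + cmFamilyRank Φ'` (`dim MT(H¹(X × Y)) + 1 = dim MT(H¹X) + dim MT(H¹Y)`, i.e.
`Hg(X × Y) = Hg(X) × Hg(Y)`) **iff** `HodgeTheory.HodgeClassesProductSpan (⨁_j A_{π j}) (⨁_j A'_{π' j})` for ALL slot
maps `π : Fin N → Fin n`, `π' : Fin N' → Fin m` (all products of copies, in particular all `X^k × Y^l`); the equal powers
`X^{a+1} × Y^{a+1}` suffice (`…_iff_forall_hodgeClassesProductSpan_pow`).  The readings on varieties (`X.powSucc a`) and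
the INTRINSIC form for `X`, `Y` of CM type are in the sequel `…/HodgeClassesProductSpanCMProductsPowersIntrinsic`.
Direction ⟸ is the tree's (`hodgeClassesProductSpan_biproduct_slots_of_typeRank_add`); direction ⟹ is NEW — the half
of Moonen–Zarhin's (3.1) "`Hg(X₁ × X₂) = Hg(X₁) × Hg(X₂)` iff all Hodge classes on all `X₁^k × X₂^l` are generated by
those of the factors" that the tree did not have (`CMTypeRankTwoBlocksConverse`: "NOT here").

PROOF of ⟹ (`exists_not_hodgeClassesProductSpan_pow_of_typeRank_lt`).  If additivity fails, the two-block calculus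
gives an `ℕ`-valued weight `g` on `(⊔_i Hom(K_i,ℂ)) ⊔ (⊔_j Hom(K'_j,ℂ))` balanced for the glued type with an unbalanced
block (`exists_nat_isBalanced_sum_not_isBalanced_of_typeRank_lt`).  With `a + 1 ≥ max g` slots over every index (slot
map `Milne1999.flatIndex a` of the flattened power `(⨁ A)^{a+1} ≅ ⨁_{j<(a+1)n} A_{κ j}`) there are slot weights `S₁`,
`S₂` with multiplicity functions `g ∘ inl`, `g ∘ inr` (`exists_finset_famMult_flatIndex_eq`); the glued `0/1`-weight
`S₁ ⊔ S₂` of `X^{a+1} × Y^{a+1}` is balanced (`isBalanced_indicator_disjSum_iff`: its push-forward is `g`), so by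
`blocksSplit_of_hodgeClassesProductSpan_biproduct` on the power its blocks are balanced, i.e.
(`CMAlgebra.isGaloisBalancedAlg_slots_iff`) `g ∘ inl`, `g ∘ inr` are — contradiction.  Geometrically: the monomial
`u_{S₁ ⊔ S₂}` spans a rational Hodge line of `X^{a+1} × Y^{a+1}` outside the span of exterior products.  Theorems only;
no definition, no named fact; axioms `propext`, `Classical.choice`, `Quot.sound`.

## References
* [MoonenZarhin1999LowDim] B. Moonen, Yu. Zarhin, Math. Ann. 315 (1999) 711–733, §3 (3.1).
* [Gordon1999HodgeAVSurvey] B. B. Gordon, *A survey of the Hodge conjecture for abelian varieties*, 7.5–7.7, 9.1–9.2.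
* [Deligne1982HodgeCycles] P. Deligne, *Hodge cycles on abelian varieties*, LNM 900 (1982), I Ex. 3.7 (c).
* [GaoUllmo2025] Z. Gao, E. Ullmo, J. Inst. Math. Jussieu 25 (2025), Thm. 3.1 (3.2) (Pohlmann's condition for a CM algebra).
* [MumfordAV1970] D. Mumford, *Abelian Varieties* (1970), §19 (products).
-/

noncomputable section

open CategoryTheory CategoryTheory.Limits NumberField

namespace Literature.AlgebraicGeometry.Pohlmann1968

open Module
open Literature.AlgebraicGeometry.Motives (AbelianVariety CMType)
open Literature.AlgebraicGeometry.HodgeTheory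
open Literature.AlgebraicGeometry.ComplexMultiplication (IsCMTypeRealisation)
open Literature.AlgebraicGeometry.Milne1999 (flatIndex)
open Literature.NumberTheory.ComplexMultiplication

/-! ### §1 Slot weights with prescribed multiplicities on the flattened power `⨁_{j<(a+1)n} A_{κ j}` -/

section SlotWeights

open scoped Classical

variable {n : ℕ} {K : Fin n → Type} [∀ i, Field (K i)] [∀ i, NumberField (K i)]

omit [∀ i, NumberField (K i)] in
/-- Unfolding of `famMult` (the number of members of `S` over `y`). [folklore] -/
private theorem famMult_eq_card_filter {N : ℕ} (π : Fin N → Fin n)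
    (S : Finset ((j : Fin N) × (K (π j) →+* ℂ))) (y : (i : Fin n) × (K i →+* ℂ)) :
    CMAlgebra.famMult π S y = (S.filter fun x => CMAlgebra.slotProj π x = y).card := by
  rw [CMAlgebra.famMult]
  convert rfl

/-- **Slot weights with prescribed multiplicities.**  For every `ℕ`-valued weight `g` on `⊔_i Hom(K_i, ℂ)` bounded by
`a + 1` there is a `0/1`-weight `S ⊆ ⊔_{j<(a+1)n} Hom(K_{κ j}, ℂ)` of the flattened power with `a + 1` slots over every
index whose multiplicity function is `g`: `S = {(j, s) | level(j) < g(κ j, s)}`. [cite: Gordon1999HodgeAVSurvey, 7.5 and §9.1 (weights of monomials on powers)] -/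
theorem exists_finset_famMult_flatIndex_eq (a : ℕ) (g : ((i : Fin n) × (K i →+* ℂ)) → ℕ) (hg : ∀ y, g y ≤ a + 1) :
    ∃ S : Finset ((j : Fin ((a + 1) * n)) × (K (flatIndex a j) →+* ℂ)),
      ∀ y, CMAlgebra.famMult (flatIndex a) S y = g y := by
  refine ⟨Finset.univ.filter fun x =>
    ((finProdFinEquiv.symm x.1).1 : ℕ) < g (CMAlgebra.slotProj (flatIndex a) x), fun y => ?_⟩
  -- the slot-embedding in level `t` over `y = (i, s)`: `(κ⁻¹(t, i), s)`
  have hidx : ∀ t : Fin (a + 1), y.1 = flatIndex a (finProdFinEquiv (t, y.1)) := fun t => by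
    rw [Milne1999.flatIndex, Equiv.symm_apply_apply]
  let lift : Fin (a + 1) → (j : Fin ((a + 1) * n)) × (K (flatIndex a j) →+* ℂ) := fun t =>
    ⟨finProdFinEquiv (t, y.1), cast (congrArg (fun i : Fin n => (K i →+* ℂ)) (hidx t)) y.2⟩
  have hproj : ∀ t, CMAlgebra.slotProj (flatIndex a) (lift t) = y := fun t => by
    obtain ⟨i, s⟩ := y
    rw [CMAlgebra.slotProj_apply]
    exact Sigma.ext (hidx t).symm (cast_heq _ _)
  have hlev : ∀ t, (finProdFinEquiv.symm (lift t).1).1 = t := fun t => by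
    dsimp only [lift]
    rw [Equiv.symm_apply_apply]
  rw [famMult_eq_card_filter, Finset.filter_filter]
  have himage : ((Finset.univ.filter fun x : (j : Fin ((a + 1) * n)) × (K (flatIndex a j) →+* ℂ) =>
      ((finProdFinEquiv.symm x.1).1 : ℕ) < g (CMAlgebra.slotProj (flatIndex a) x) ∧
        CMAlgebra.slotProj (flatIndex a) x = y).image fun x => ((finProdFinEquiv.symm x.1).1 : ℕ)) =
      Finset.range (g y) := by
    ext t
    simp only [Finset.mem_image, Finset.mem_filter, Finset.mem_univ, true_and, Finset.mem_range]
    constructor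
    · rintro ⟨x, ⟨hx, hxy⟩, rfl⟩
      rwa [hxy] at hx
    · intro ht
      refine ⟨lift ⟨t, lt_of_lt_of_le ht (hg y)⟩, ⟨?_, hproj _⟩, ?_⟩
      · rw [hlev, hproj]; exact ht
      · rw [hlev]
  rw [← Finset.card_range (g y), ← himage, Finset.card_image_of_injOn]
  rintro x hx x' hx' hxx'
  simp only [Finset.coe_filter, Set.mem_setOf_eq, Finset.mem_univ, true_and] at hx hx'
  have hyy := hx.2.trans hx'.2.symm
  rw [CMAlgebra.slotProj_apply, CMAlgebra.slotProj_apply] at hyy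
  obtain ⟨hi, hs⟩ := Sigma.mk.inj hyy
  have h1 : finProdFinEquiv.symm x.1 = finProdFinEquiv.symm x'.1 := Prod.ext (Fin.ext hxx') hi
  exact Sigma.ext (finProdFinEquiv.symm.injective h1) hs

end SlotWeights

/-! ### §2 Indicators of slot weights: fibre sums are multiplicities; the glued slot weight `S₁ ⊔ S₂` -/

section Indicator

open scoped Classical

variable {n m : ℕ} {K : Fin n → Type} {K' : Fin m → Type} [∀ i, Field (K i)] [∀ j, Field (K' j)]
  [∀ i, NumberField (K i)] [∀ j, NumberField (K' j)]

/-- `Σ_x 𝟙_S(x) F(pr x) = Σ_y mult_S(y) F(y)`: a sum over the slot-embeddings of a product of copies, weighted by the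
indicator of `S`, is the sum over the base index set weighted by the multiplicities of `S`. [folklore] -/
private theorem sum_indicator_mul_comp_slotProj {N : ℕ} (π : Fin N → Fin n)
    (S : Finset ((j : Fin N) × (K (π j) →+* ℂ))) (F : ((i : Fin n) × (K i →+* ℂ)) → ℚ) :
    ∑ x, (if x ∈ S then (1 : ℚ) else 0) * F (CMAlgebra.slotProj π x) =
      ∑ y, (CMAlgebra.famMult π S y : ℚ) * F y := by
  rw [← Finset.sum_fiberwise Finset.univ (CMAlgebra.slotProj π)
    (fun x => (if x ∈ S then (1 : ℚ) else 0) * F (CMAlgebra.slotProj π x))]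
  refine Finset.sum_congr rfl fun y _ => ?_
  have h1 : ∑ x ∈ Finset.univ.filter (fun x => CMAlgebra.slotProj π x = y),
      (if x ∈ S then (1 : ℚ) else 0) * F (CMAlgebra.slotProj π x) =
      ∑ x ∈ Finset.univ.filter (fun x => CMAlgebra.slotProj π x = y), (if x ∈ S then (1 : ℚ) else 0) * F y :=
    Finset.sum_congr rfl fun x hx => by rw [(Finset.mem_filter.1 hx).2]
  rw [h1, ← Finset.sum_mul, Finset.sum_boole]
  congr 2
  rw [famMult_eq_card_filter, Finset.filter_filter]
  congr 1
  ext x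
  simp only [Finset.mem_filter, Finset.mem_univ, true_and, and_comm]

omit [∀ i, NumberField (K i)] [∀ j, NumberField (K' j)] in
/-- The indicator of a translate of the glued SLOT type at a slot-embedding of the first block is the indicator of the
corresponding translate of the base family type at its projection. [cite: Deligne1982HodgeCycles, I Ex. 3.7 (c)] -/
private theorem translateInd_glued_slots_inl {N N' : ℕ} (Φ : ∀ i, CMType (K i)) (Φ' : ∀ j, CMType (K' j))
    (π : Fin N → Fin n) (π' : Fin N' → Fin m) (τ : ℂ ≃+* ℂ) (x : (j : Fin N) × (K (π j) →+* ℂ)) :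
    translateInd {z : ((j : Fin N) × (K (π j) →+* ℂ)) ⊕ ((j : Fin N') × (K' (π' j) →+* ℂ)) |
        Sum.elim (· ∈ CMAlgebra.familyType (fun j => Φ (π j))) (· ∈ CMAlgebra.familyType (fun j => Φ' (π' j))) z}
        τ (Sum.inl x) =
      translateInd (CMAlgebra.familyType Φ) τ (CMAlgebra.slotProj π x) := by
  rw [translateInd_sum_inl, CMAlgebra.translateInd_familyType, CMAlgebra.translateInd_familyType]
  rfl

omit [∀ i, NumberField (K i)] [∀ j, NumberField (K' j)] in
/-- Second-block companion of `translateInd_glued_slots_inl`. [cite: Deligne1982HodgeCycles, I Ex. 3.7 (c)] -/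
private theorem translateInd_glued_slots_inr {N N' : ℕ} (Φ : ∀ i, CMType (K i)) (Φ' : ∀ j, CMType (K' j))
    (π : Fin N → Fin n) (π' : Fin N' → Fin m) (τ : ℂ ≃+* ℂ) (x : (j : Fin N') × (K' (π' j) →+* ℂ)) :
    translateInd {z : ((j : Fin N) × (K (π j) →+* ℂ)) ⊕ ((j : Fin N') × (K' (π' j) →+* ℂ)) |
        Sum.elim (· ∈ CMAlgebra.familyType (fun j => Φ (π j))) (· ∈ CMAlgebra.familyType (fun j => Φ' (π' j))) z}
        τ (Sum.inr x) =
      translateInd (CMAlgebra.familyType Φ') τ (CMAlgebra.slotProj π' x) := by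
  rw [translateInd_sum_inr, CMAlgebra.translateInd_familyType, CMAlgebra.translateInd_familyType]
  rfl

/-- **The glued slot weight `S₁ ⊔ S₂` is balanced for the glued slot type iff the glued multiplicity function
`(mult_{S₁}, mult_{S₂})` is balanced for the glued base type** (Pohlmann's condition counts slot-embeddings; over each
point of the base index set there are `mult` of them). [cite: Gordon1999HodgeAVSurvey, §9.2 (9.2.1)]
[cite: GaoUllmo2025, Thm. 3.1 (3.2)] -/
theorem isBalanced_indicator_disjSum_iff {N N' : ℕ} (Φ : ∀ i, CMType (K i)) (Φ' : ∀ j, CMType (K' j))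
    (π : Fin N → Fin n) (π' : Fin N' → Fin m) (S₁ : Finset ((j : Fin N) × (K (π j) →+* ℂ)))
    (S₂ : Finset ((j : Fin N') × (K' (π' j) →+* ℂ))) :
    IsBalanced (ℂ ≃+* ℂ)
        {z : ((j : Fin N) × (K (π j) →+* ℂ)) ⊕ ((j : Fin N') × (K' (π' j) →+* ℂ)) |
          Sum.elim (· ∈ CMAlgebra.familyType (fun j => Φ (π j))) (· ∈ CMAlgebra.familyType (fun j => Φ' (π' j))) z}
        (fun z => if z ∈ S₁.disjSum S₂ then (1 : ℚ) else 0) ↔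
      IsBalanced (ℂ ≃+* ℂ)
        {z : ((i : Fin n) × (K i →+* ℂ)) ⊕ ((j : Fin m) × (K' j →+* ℂ)) |
          Sum.elim (· ∈ CMAlgebra.familyType Φ) (· ∈ CMAlgebra.familyType Φ') z}
        (fun z => Sum.elim (fun y => (CMAlgebra.famMult π S₁ y : ℚ)) (fun y => (CMAlgebra.famMult π' S₂ y : ℚ)) z) := by
  -- the total mass
  have htot : ∑ z, (if z ∈ S₁.disjSum S₂ then (1 : ℚ) else 0) =
      ∑ z, Sum.elim (fun y => (CMAlgebra.famMult π S₁ y : ℚ)) (fun y => (CMAlgebra.famMult π' S₂ y : ℚ)) z := by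
    rw [Fintype.sum_sum_type, Fintype.sum_sum_type]
    simp only [Finset.inl_mem_disjSum, Finset.inr_mem_disjSum, Sum.elim_inl, Sum.elim_inr]
    have e1 := sum_indicator_mul_comp_slotProj π S₁ (fun _ => 1)
    have e2 := sum_indicator_mul_comp_slotProj π' S₂ (fun _ => 1)
    simp only [mul_one] at e1 e2
    rw [e1, e2]
  -- the weighted mass against every translate
  have hwt : ∀ τ : ℂ ≃+* ℂ,
      ∑ z, (if z ∈ S₁.disjSum S₂ then (1 : ℚ) else 0) *
          translateInd {z : ((j : Fin N) × (K (π j) →+* ℂ)) ⊕ ((j : Fin N') × (K' (π' j) →+* ℂ)) |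
            Sum.elim (· ∈ CMAlgebra.familyType (fun j => Φ (π j)))
              (· ∈ CMAlgebra.familyType (fun j => Φ' (π' j))) z} τ z =
        ∑ z, Sum.elim (fun y => (CMAlgebra.famMult π S₁ y : ℚ)) (fun y => (CMAlgebra.famMult π' S₂ y : ℚ)) z *
          translateInd {z : ((i : Fin n) × (K i →+* ℂ)) ⊕ ((j : Fin m) × (K' j →+* ℂ)) |
            Sum.elim (· ∈ CMAlgebra.familyType Φ) (· ∈ CMAlgebra.familyType Φ') z} τ z := by
    intro τ
    rw [Fintype.sum_sum_type, Fintype.sum_sum_type]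
    simp only [Finset.inl_mem_disjSum, Finset.inr_mem_disjSum, Sum.elim_inl, Sum.elim_inr,
      translateInd_glued_slots_inl Φ Φ' π π', translateInd_glued_slots_inr Φ Φ' π π',
      translateInd_sum_inl (CMAlgebra.familyType Φ) (CMAlgebra.familyType Φ'),
      translateInd_sum_inr (CMAlgebra.familyType Φ) (CMAlgebra.familyType Φ')]
    rw [sum_indicator_mul_comp_slotProj π S₁ (fun y => translateInd (CMAlgebra.familyType Φ) τ y),
      sum_indicator_mul_comp_slotProj π' S₂ (fun y => translateInd (CMAlgebra.familyType Φ') τ y)]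
  refine forall_congr' fun τ => ?_
  rw [hwt τ, htot]

end Indicator

/-! ### §3 Failure of rank additivity ⟹ an exceptional Hodge class on some power `X^{a+1} × Y^{a+1}` -/

section Main

variable {n m : ℕ} {K : Fin n → Type} {K' : Fin m → Type}
  [∀ i, Field (K i)] [∀ i, NumberField (K i)] [∀ j, Field (K' j)] [∀ j, NumberField (K' j)]
  [∀ i, IsCMField (K i)] [∀ j, IsCMField (K' j)]
  {Φ : ∀ i, CMType (K i)} {Φ' : ∀ j, CMType (K' j)}
  {A : Fin n → AbelianVariety ℂ} {A' : Fin m → AbelianVariety ℂ}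
  {ι : ∀ i, 𝓞 (K i) →+* End (A i)} {ι' : ∀ j, 𝓞 (K' j) →+* End (A' j)}
  {θ : ∀ i, K i →+* Module.End ℂ (complexBetti (A i).X 1)}
  {θ' : ∀ j, K' j →+* Module.End ℂ (complexBetti (A' j).X 1)}

/-- `#{z ∈ T | Q z} + #{z ∈ T | ¬Q z} = |T|`. [folklore] -/
private theorem ncard_add_ncard_not' {γ : Type*} (T : Finset γ) (Q : γ → Prop) :
    {z | z ∈ T ∧ Q z}.ncard + {z | z ∈ T ∧ ¬ Q z}.ncard = T.card := by
  classical
  have hdisj : Disjoint {z | z ∈ T ∧ Q z} {z | z ∈ T ∧ ¬ Q z} :=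
    Set.disjoint_left.mpr fun z hz hz' => hz'.2 hz.2
  have hunion : {z | z ∈ T ∧ Q z} ∪ {z | z ∈ T ∧ ¬ Q z} = (T : Set γ) := by
    ext z
    simp only [Set.mem_union, Set.mem_setOf_eq, Finset.mem_coe]
    tauto
  have hfin₁ : {z | z ∈ T ∧ Q z}.Finite := T.finite_toSet.subset fun z hz => hz.1
  have hfin₂ : {z | z ∈ T ∧ ¬ Q z}.Finite := T.finite_toSet.subset fun z hz => hz.1
  rw [← Set.ncard_union_eq hdisj hfin₁ hfin₂, hunion, Set.ncard_coe_finset]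

/-- From `#{z ∈ T | Q_τ z} = #{z ∈ T | ¬Q_τ z}` for all `τ` to the engine's form "exactly `p` inside and `p` outside"
with `p = #{z ∈ T | Q_1 z}`. [cite: GaoUllmo2025, Thm. 3.1 (3.2)] -/
private theorem forall_ncard_eq_and_of_forall_ncard_eq {γ ι₀ : Type*} (T : Finset γ) (Q : ι₀ → γ → Prop) (τ₀ : ι₀)
    (h : ∀ τ, {z | z ∈ T ∧ Q τ z}.ncard = {z | z ∈ T ∧ ¬ Q τ z}.ncard) :
    ∀ τ, {z | z ∈ T ∧ Q τ z}.ncard = {z | z ∈ T ∧ Q τ₀ z}.ncard ∧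
      {z | z ∈ T ∧ ¬ Q τ z}.ncard = {z | z ∈ T ∧ Q τ₀ z}.ncard := by
  intro τ
  have h0 := ncard_add_ncard_not' T (Q τ₀)
  have h1 := ncard_add_ncard_not' T (Q τ)
  have h2 := h τ
  have h3 := h τ₀
  omega

/-- **Failure of rank additivity ⟹ some power `X^{a+1} × Y^{a+1}` carries a rational Hodge class outside the span of
exterior products.**  For realisations `A_i` of CM types `Φ_i` of CM fields `K_i` (`i < n`) and `A'_j` of `Φ'_j` of `K'_j`
(`j < m`): if `rank(Σ ⊔ Σ') + 1 < cmFamilyRank Φ + cmFamilyRank Φ'` (`Hg(X × Y) ⊊ Hg(X) × Hg(Y)`), then for some `a`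
the flattened powers `⨁_{j<(a+1)n} A_{κ j} ≅ (⨁ A)^{a+1}`, `⨁_{j<(a+1)m} A'_{κ j} ≅ (⨁ A')^{a+1}` do NOT have the
product-span property — Moonen–Zarhin (3.1), direction "all powers spanned ⟹ `Hg` splits", for CM abelian varieties.
[cite: MoonenZarhin1999LowDim, §3 (3.1)] [cite: Gordon1999HodgeAVSurvey, 7.5 (1) ⟹ (3)] -/
theorem exists_not_hodgeClassesProductSpan_pow_of_typeRank_lt [NeZero n] [NeZero m]
    (hA : ∀ i, IsCMTypeRealisation (Φ i) (A i) (ι i) (θ i))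
    (hA' : ∀ j, IsCMTypeRealisation (Φ' j) (A' j) (ι' j) (θ' j))
    (hlt : typeRank (ℂ ≃+* ℂ) {z : (Σ i, (K i →+* ℂ)) ⊕ (Σ j, (K' j →+* ℂ)) |
        Sum.elim (· ∈ CMAlgebra.familyType Φ) (· ∈ CMAlgebra.familyType Φ') z} + 1 <
      CMAlgebra.cmFamilyRank Φ + CMAlgebra.cmFamilyRank Φ') :
    ∃ a : ℕ, ¬ HodgeClassesProductSpan (⨁ fun j : Fin ((a + 1) * n) => A (flatIndex a j))
      (⨁ fun j : Fin ((a + 1) * m) => A' (flatIndex a j)) := by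
  classical
  haveI : Nonempty (Σ i, (K i →+* ℂ)) := by
    obtain ⟨s⟩ := (inferInstance : Nonempty (K 0 →+* ℂ)); exact ⟨⟨0, s⟩⟩
  haveI : Nonempty (Σ j, (K' j →+* ℂ)) := by
    obtain ⟨t⟩ := (inferInstance : Nonempty (K' 0 →+* ℂ)); exact ⟨⟨0, t⟩⟩
  -- an `ℕ`-weight balanced for the glued type with an unbalanced block
  obtain ⟨g, hg, hnot⟩ := exists_nat_isBalanced_sum_not_isBalanced_of_typeRank_lt
    (CMAlgebra.isCMTypeWith_familyType Φ) (CMAlgebra.isCMTypeWith_familyType Φ') hlt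
  -- `a + 1 = Σ g` levels suffice
  set a : ℕ := ∑ z, g z with ha
  have hle : ∀ z, g z ≤ a + 1 := fun z =>
    (Finset.single_le_sum (fun z _ => Nat.zero_le (g z)) (Finset.mem_univ z)).trans (Nat.le_succ a)
  obtain ⟨S₁, hS₁⟩ := exists_finset_famMult_flatIndex_eq a (fun y => g (Sum.inl y)) fun y => hle _
  obtain ⟨S₂, hS₂⟩ := exists_finset_famMult_flatIndex_eq a (fun y => g (Sum.inr y)) fun y => hle _
  refine ⟨a, fun hspan => hnot ?_⟩
  -- the glued slot weight `S₁ ⊔ S₂` is balanced for the glued slot type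
  have hmult : (fun z : (Σ i, (K i →+* ℂ)) ⊕ (Σ j, (K' j →+* ℂ)) =>
      Sum.elim (fun y => (CMAlgebra.famMult (flatIndex a) S₁ y : ℚ))
        (fun y => (CMAlgebra.famMult (flatIndex a) S₂ y : ℚ)) z) = fun z => (g z : ℚ) := by
    funext z
    rcases z with y | y
    · rw [Sum.elim_inl, hS₁]
    · rw [Sum.elim_inr, hS₂]
  have hbal := (isBalanced_indicator_disjSum_iff Φ Φ' (flatIndex a) (flatIndex a) S₁ S₂).2 (hmult ▸ hg)
  -- in the counting form of the engine, then the product-span hypothesis on the power splits the blocks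
  have hcount := (isBalanced_indicator_iff_forall_ncard_eq (G := ℂ ≃+* ℂ) _ (S₁.disjSum S₂)).1 hbal
  simp only [smul_mem_sum_familyType_iff] at hcount
  obtain ⟨p₁, p₂, -, h₁, h₂⟩ := blocksSplit_of_hodgeClassesProductSpan_biproduct
    (K := fun j => K (flatIndex a j)) (K' := fun j => K' (flatIndex a j))
    (Φ := fun j => Φ (flatIndex a j)) (Φ' := fun j => Φ' (flatIndex a j))
    (fun j => hA (flatIndex a j)) (fun j => hA' (flatIndex a j)) hspan (S₁.disjSum S₂) _
    (forall_ncard_eq_and_of_forall_ncard_eq _ _ 1 hcount)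
  rw [Finset.toLeft_disjSum] at h₁
  rw [Finset.toRight_disjSum] at h₂
  have hb₁ := (CMAlgebra.isGaloisBalancedAlg_slots_iff Φ (flatIndex a) S₁).1 h₁.2
  have hb₂ := (CMAlgebra.isGaloisBalancedAlg_slots_iff Φ' (flatIndex a) S₂).1 h₂.2
  simp only [hS₁] at hb₁
  simp only [hS₂] at hb₂
  exact ⟨hb₁, hb₂⟩

omit [∀ i, IsCMField (K i)] [∀ j, IsCMField (K' j)] in
/-- `rank(Σ ⊔ Σ') + 1 ≠ cmFamilyRank Φ + cmFamilyRank Φ'` means `<` (the inequality `≤` always holds).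
[cite: Gordon1999HodgeAVSurvey, 7.7] -/
private theorem typeRank_sum_lt_of_ne [NeZero n] [NeZero m] [∀ i, IsCMField (K i)] [∀ j, IsCMField (K' j)]
    (Φ : ∀ i, CMType (K i)) (Φ' : ∀ j, CMType (K' j))
    (hne : ¬ (typeRank (ℂ ≃+* ℂ) {z : (Σ i, (K i →+* ℂ)) ⊕ (Σ j, (K' j →+* ℂ)) |
        Sum.elim (· ∈ CMAlgebra.familyType Φ) (· ∈ CMAlgebra.familyType Φ') z} + 1 =
      CMAlgebra.cmFamilyRank Φ + CMAlgebra.cmFamilyRank Φ')) :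
    typeRank (ℂ ≃+* ℂ) {z : (Σ i, (K i →+* ℂ)) ⊕ (Σ j, (K' j →+* ℂ)) |
        Sum.elim (· ∈ CMAlgebra.familyType Φ) (· ∈ CMAlgebra.familyType Φ') z} + 1 <
      CMAlgebra.cmFamilyRank Φ + CMAlgebra.cmFamilyRank Φ' := by
  haveI : Nonempty (Σ i, (K i →+* ℂ)) := by
    obtain ⟨s⟩ := (inferInstance : Nonempty (K 0 →+* ℂ)); exact ⟨⟨0, s⟩⟩
  haveI : Nonempty (Σ j, (K' j →+* ℂ)) := by
    obtain ⟨t⟩ := (inferInstance : Nonempty (K' 0 →+* ℂ)); exact ⟨⟨0, t⟩⟩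
  exact lt_of_le_of_ne
    (typeRank_sum_add_one_le (CMAlgebra.isCMTypeWith_familyType Φ) (CMAlgebra.isCMTypeWith_familyType Φ')) hne

/-- `Fin ((a+1) n)` is non-empty for `n ≠ 0`. [folklore] -/
private theorem neZero_succ_mul (a k : ℕ) [NeZero k] : NeZero ((a + 1) * k) :=
  ⟨Nat.mul_ne_zero (Nat.succ_ne_zero a) (NeZero.ne k)⟩

/-- **Moonen–Zarhin (3.1) for CM products is an EQUIVALENCE, slot form.**  For realisations `A_i`, `A'_j` of CM types of
CM fields: `rank(Σ ⊔ Σ') + 1 = cmFamilyRank Φ + cmFamilyRank Φ'` (`Hg(X × Y) = Hg(X) × Hg(Y)` for `X = ⨁ A`,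
`Y = ⨁ A'`) iff for ALL slot maps `π : Fin N → Fin n`, `π' : Fin N' → Fin m` (`N, N' ≠ 0`) — all products of copies
`∏ A_i^{k_i} × ∏ A'_j^{l_j}`, in particular all `X^k × Y^l` — the Hodge classes of `(⨁_j A_{π j}) × (⨁_j A'_{π' j})` are
spanned by exterior products of Hodge classes of the two factors. [cite: MoonenZarhin1999LowDim, §3 (3.1)]
[cite: Gordon1999HodgeAVSurvey, 7.5] -/
theorem typeRank_sum_add_one_eq_iff_forall_hodgeClassesProductSpan_slots [NeZero n] [NeZero m]
    (hA : ∀ i, IsCMTypeRealisation (Φ i) (A i) (ι i) (θ i))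
    (hA' : ∀ j, IsCMTypeRealisation (Φ' j) (A' j) (ι' j) (θ' j)) :
    typeRank (ℂ ≃+* ℂ) {z : (Σ i, (K i →+* ℂ)) ⊕ (Σ j, (K' j →+* ℂ)) |
        Sum.elim (· ∈ CMAlgebra.familyType Φ) (· ∈ CMAlgebra.familyType Φ') z} + 1 =
      CMAlgebra.cmFamilyRank Φ + CMAlgebra.cmFamilyRank Φ' ↔
    ∀ (N N' : ℕ) [NeZero N] [NeZero N'] (π : Fin N → Fin n) (π' : Fin N' → Fin m),
      HodgeClassesProductSpan (⨁ fun j => A (π j)) (⨁ fun j => A' (π' j)) := by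
  refine ⟨fun hrank N N' _ _ π π' => hodgeClassesProductSpan_biproduct_slots_of_typeRank_add hA hA' hrank π π',
    fun h => ?_⟩
  by_contra hne
  obtain ⟨a, ha⟩ := exists_not_hodgeClassesProductSpan_pow_of_typeRank_lt hA hA' (typeRank_sum_lt_of_ne Φ Φ' hne)
  haveI := neZero_succ_mul a n
  haveI := neZero_succ_mul a m
  exact ha (h ((a + 1) * n) ((a + 1) * m) (flatIndex a) (flatIndex a))

/-- **Equal powers suffice**: `rank(Σ ⊔ Σ') + 1 = cmFamilyRank Φ + cmFamilyRank Φ'` iff every flattened power pair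
`(⨁_{j<(a+1)n} A_{κ j}, ⨁_{j<(a+1)m} A'_{κ j}) ≅ (X^{a+1}, Y^{a+1})` has the product-span property.
[cite: MoonenZarhin1999LowDim, §3 (3.1)] -/
theorem typeRank_sum_add_one_eq_iff_forall_hodgeClassesProductSpan_pow [NeZero n] [NeZero m]
    (hA : ∀ i, IsCMTypeRealisation (Φ i) (A i) (ι i) (θ i))
    (hA' : ∀ j, IsCMTypeRealisation (Φ' j) (A' j) (ι' j) (θ' j)) :
    typeRank (ℂ ≃+* ℂ) {z : (Σ i, (K i →+* ℂ)) ⊕ (Σ j, (K' j →+* ℂ)) |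
        Sum.elim (· ∈ CMAlgebra.familyType Φ) (· ∈ CMAlgebra.familyType Φ') z} + 1 =
      CMAlgebra.cmFamilyRank Φ + CMAlgebra.cmFamilyRank Φ' ↔
    ∀ a : ℕ, HodgeClassesProductSpan (⨁ fun j : Fin ((a + 1) * n) => A (flatIndex a j))
      (⨁ fun j : Fin ((a + 1) * m) => A' (flatIndex a j)) := by
  refine ⟨fun hrank a => ?_, fun h => ?_⟩
  · haveI := neZero_succ_mul a n
    haveI := neZero_succ_mul a m
    exact hodgeClassesProductSpan_biproduct_slots_of_typeRank_add hA hA' hrank (flatIndex a) (flatIndex a)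
  · by_contra hne
    obtain ⟨a, ha⟩ := exists_not_hodgeClassesProductSpan_pow_of_typeRank_lt hA hA' (typeRank_sum_lt_of_ne Φ Φ' hne)
    exact ha (h a)

end Main

end Literature.AlgebraicGeometry.Pohlmann1968

end
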